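import Mathlib
import Summits.NavierStokesRegularity.NavierStokesRegularity.Theorems.TaoLadderRungTwoBreakOneShiftMapDefs
import Summits.NavierStokesRegularity.NavierStokesRegularity.Theorems.TaoLadderRungTwoBreakCircuitTableDefs
import Summits.NavierStokesRegularity.NavierStokesRegularity.Theorems.TaoLadderRungTwoBreakOneShiftT4W76Defs
import HarnessLib

/-!
# The one-shift instance B8 @ ε₀ = 2/25, W = 91 — DEFINITIONS (frame, closed-form tails, rate / amplitude /
# window-Lipschitz functions) for the instantiable end `exists_surviving_dssWave_of_windowCert_v7s` of the
# kernel STAGE-3 chain (cell harvest/h2-tao-ladder, seat p2; rung1/INSTANCE-SHEET-T4-0.1-W76.md (the B8 instance follows the same sheet),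
# rung1/KERNEL-STAGE3-PLAN.md §6; support for K1(1) = `NoSurvivingDSSOne`, stmt-NavierStokesRegularity-20205)

MODEL lattice only (the comparable circuit table B8 = `circuitTable 1 0.61103 0.14881 0.22427 (Λ₀·0.70928)` on Tao's
shift set, scale ratio `1 + ε₀ = 27/25`); nothing here is a statement about the Navier–Stokes equations;
nothing is asserted — this module only DEFINES the objects of the instance, with EXACT RATIONAL constants read
off (and rounded outward from) the row of record `B8 @ 0.08, W = 91` of p2's interval engine v7.5 (kit j304115;
rung1/logs/num4c/j304115_certify_B8_0.08_91_22_s3.log, …_box_…s3.txt.s3) and the checker rung1/num4c/v7s_check.py: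

* scalars: `gLo ≤ ĝ ≤ gHi` (hull of the renormalisation factor), wake weight ratio `θw = 2 gHi`, wake amplitude
  ratio `βw = 1.01 gHi`, wake radii `r₀ + κw (n+1)`, `cmax ≥ |ŷ_{·,0}|`, `Q`, `S = 2.62 ≥ Σ|α|_i`, top scales
  `εR = 10⁻³⁰`, `ωt = 5·10⁻³¹`, `abart = 1.01·10⁻²⁴`, flight time `τc ± rτ`;
* `BoxData` — the part of the frame that belongs to the CERTIFICATE (Krawczyk box centre / radii on the window,
  section site and level), with the two scalar facts the rows use (`|ŷ_{i,0}| ≤ cmax`, some `|ŷ_{i,0}| > a_{i,0}`);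
* `wtB8`, `tubeRB8`, `tubeCB8` and `frame bd : OneShiftFrame 4` (W = 91, B = 2, Eb = 59/100, Et = εR);
* `AB8` (amplitude hulls: `Q βw^{|k|}` on the wake, `εR 2^{-(k-91)}` on the top, `0.57474 / 1.11 / abart` on the
  window shells `0 / 1…89 / 90`), `RB8` (TABLE-SPARSE rate envelopes, pinned off the window as `…_v7s` wants),
  `vmaxB8`, `χbB8`, `χeB8` (the per-shell edge-form window Lipschitz numbers of `hDedge`, three pieces).
-/

noncomputable section

-- the sub-problem namespace repeats the summit name by design (D-0017)
set_option linter.dupNamespace false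

namespace Summit.NavierStokesRegularity.NavierStokesRegularity.Theorems

namespace DSSOneShift

open Set Literature.Analysis.FluidPDE Literature.Analysis.FluidPDE.TaoCascade

namespace B8E8W91

/-! ### Scalars (exact rationals) -/

/-- Upper end of the hull of the renormalisation factor `g` over the box (engine: `g ≤ 1.0133761019877`). [cite: Tao2016AveragedNS, §5.3 (rescaling between epochs); cell vocabulary, harvest/h2-tao-ladder rung1/INSTANCE-SHEET-T4-0.1-W76.md (the B8 instance follows the same sheet)] -/
def gHi : ℝ := 10133761020 / 10 ^ 10

/-- Lower end of the hull of `g` (engine: `g ≥ 1.0133760842696`). [cite: Tao2016AveragedNS, §5.3; cell vocabulary, harvest/h2-tao-ladder rung1/INSTANCE-SHEET-T4-0.1-W76.md (the B8 instance follows the same sheet)] -/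
def gLo : ℝ := 10133760842 / 10 ^ 10

/-- The centre value `ĝ` (engine: `1.013376093128…`), base of the wake tube centres. [cite: Tao2016AveragedNS, §5.3; cell vocabulary, harvest/h2-tao-ladder rung1/STAGE2-LEMMA.md §2] -/
def ghat : ℝ := 10133760931 / 10 ^ 10

/-- Wake weight ratio `θ = 2 gHi` (`ζ′ = 2 gHi/ĝ`), so that `gHi/θ = 1/2`. [cite: Tao2016AveragedNS, §4; cell vocabulary, harvest/h2-tao-ladder rung1/STAGE3-BANACH.md §1] -/
def θw : ℝ := 2 * gHi

/-- Wake amplitude ratio `β = gHi (1 + 1/100)`. [cite: Tao2016AveragedNS, §4; cell vocabulary, harvest/h2-tao-ladder rung1/INSTANCE-SHEET-T4-0.1-W76.md (the B8 instance follows the same sheet) (δ′ = 0.01)] -/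
def βw : ℝ := gHi * (1 + 1 / 100)

/-- Wake radius increment per shell `κ = 3.7·10⁻⁵` (≈ 3 κ_min of the checker). [cite: Tao2016AveragedNS, §4; cell vocabulary, harvest/h2-tao-ladder rung1/STAGE2-LEMMA.md §5 (Lemma 4a)] -/
def κw : ℝ := 37 / 10 ^ 6

/-- Wake radius offset `r₀ = 1.5·10⁻⁵` (so that `gHi (r₀ + κ) ≤ d_edge = 5.2985·10⁻⁵`, the wake-edge radius the window certificate admits). [cite: Tao2016AveragedNS, §4; cell vocabulary, harvest/h2-tao-ladder rung1/num4c/v7s_check.py (v7s CHOICE)] -/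
def r₀ : ℝ := 15 / 10 ^ 6

/-- `cmax = 0.5747327 ≥ max_i |ŷ_{i,0}|` (box centre, shell 0). [cite: Tao2016AveragedNS, §4; cell vocabulary, harvest/h2-tao-ladder rung1/num4c/j294666_prob_B8_0.08_91_22_s2.txt] -/
def cmax : ℝ := 5747327 / 10 ^ 7

/-- Wake amplitude constant `Q = 0.579 ≥ cmax + r₀ + 100 κ` and `≥ A(0)`. [cite: Tao2016AveragedNS, §4; cell vocabulary, harvest/h2-tao-ladder rung1/INSTANCE-SHEET-T4-0.1-W76.md (the B8 instance follows the same sheet)] -/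
def Q : ℝ := 579 / 1000

/-- `S = 2.62 ≥ Σ_{i₁i₂μ} |α_{i₁i₂iμ}|` for every mode `i` of B8 at this `Λ₀` (`= (2.6196, 0.8353, 0.3731, 1.8598)`). [cite: Tao2016AveragedNS, §4 (4.1); cell vocabulary, harvest/h2-tao-ladder rung1/INSTANCE-SHEET-T4-0.1-W76.md (the B8 instance follows the same sheet) (RESOLUTION)] -/
def S : ℝ := 131 / 50

/-- Top tube radius scale `ε = 10⁻³⁰`. [cite: Tao2016AveragedNS, §4; cell vocabulary, harvest/h2-tao-ladder rung1/STAGE2-LEMMA.md §5 (Lemma 4b)] -/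
def εR : ℝ := 1 / 10 ^ 30

/-- Top weight scale `ε′ = 5·10⁻³¹`. [cite: Tao2016AveragedNS, §4; cell vocabulary, harvest/h2-tao-ladder rung1/STAGE3-BANACH.md §1] -/
def ωt : ℝ := 5 / 10 ^ 31

/-- Top amplitude anchor `ā_t = 1.01·10⁻²⁴ ≥ A(W-1)` (last window shell hull `1.002·10⁻²⁴`). [cite: Tao2016AveragedNS, §4; cell vocabulary, harvest/h2-tao-ladder rung1/INSTANCE-SHEET-T4-0.1-W76.md (the B8 instance follows the same sheet) (RESOLUTION)] -/
def abart : ℝ := 101 / 10 ^ 26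

/-- Flight-time centre `τ̂ = 2.2017235533145965·10⁻⁵`. [cite: Tao2016AveragedNS, §5.3; cell vocabulary, harvest/h2-tao-ladder rung1/logs/num4c (CERTIFICATE line tauhat)] -/
def τc : ℝ := 22017235533145965 / 10 ^ 21

/-- Flight-time radius `r_τ = 2.738918·10⁻¹³`. [cite: Tao2016AveragedNS, §5.3; cell vocabulary, harvest/h2-tao-ladder rung1/logs/num4c (dump header r_tau)] -/
def rτ : ℝ := 2738918 / 10 ^ 19

/-- The table: B8 in the tree normalisation (hand-off entry `Λ₀ · 0.70928`). [cite: Tao2016AveragedNS, §4 (4.1)–(4.3), §5; cell vocabulary, module …CircuitTableT4 (`inTableClass_circuitTable_B8`)] -/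
def αB8 : Fin 4 → Fin 4 → Fin 4 → ℤ × ℤ × ℤ → ℝ :=
  circuitTable 1 0.61103 0.14881 0.22427 (bigLam (2 / 25) * 0.70928)

/-! ### The certificate's share of the frame -/

/-- **Box data** — the part of the frame that is the window certificate's own output: Krawczyk box centre `yc`
and radii `a` on the window shells, the section site `D` and level `strig`; with the two scalar facts used by
the rows (`|ŷ_{i,0}| ≤ cmax`; some component of shell `0` is bounded away from `0` on the box).
[cite: Tao2016AveragedNS, §5.3; cell vocabulary, harvest/h2-tao-ladder rung1/STAGE2-LEMMA.md §2 (the box X)] -/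
structure BoxData where
  /-- box centre -/
  yc : Fin 4 → ℤ → ℝ
  /-- box radii -/
  a : Fin 4 → ℤ → ℝ
  /-- section site -/
  D : ℕ
  /-- section level -/
  strig : ℝ
  a_pos : ∀ i k, 0 < a i k
  yc_le : ∀ i, |yc i 0| ≤ cmax
  yc_ne : ∃ i, a i 0 < |yc i 0|

/-! ### Closed-form tails of the frame -/

/-- Metric weights: `θ^{|k|}` on the wake, `ε′ 2^{-(k-91)}` on the top, `1` on the window. [cite: Tao2016AveragedNS, §4; cell vocabulary, harvest/h2-tao-ladder rung1/STAGE3-BANACH.md §1] -/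
def wtB8 (k : ℤ) : ℝ :=
  if k < 0 then θw ^ (-k).toNat else if 91 ≤ k then ωt * (1 / 2) ^ (k - 91).toNat else 1

/-- Tube radii: `gHi^{|k|} (r₀ + κ |k|)` on the wake, `ε 2^{-(k-91)}` on the top, `0` on the window. [cite: Tao2016AveragedNS, §4; cell vocabulary, harvest/h2-tao-ladder rung1/STAGE2-LEMMA.md §5] -/
def tubeRB8 (k : ℤ) : ℝ :=
  if k < 0 then gHi ^ (-k).toNat * (r₀ + κw * ((-k).toNat : ℝ))
  else if 91 ≤ k then εR * (1 / 2) ^ (k - 91).toNat else 0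

/-- Tube centres: `ĝ^{|k|} ŷ_{i,0}` on the wake, `0` elsewhere. [cite: Tao2016AveragedNS, §5.3; cell vocabulary, harvest/h2-tao-ladder rung1/STAGE2-LEMMA.md §2] -/
def tubeCB8 (c₀ : Fin 4 → ℝ) (i : Fin 4) (k : ℤ) : ℝ :=
  if k < 0 then ghat ^ (-k).toNat * c₀ i else 0

/-- The weights are positive. [folklore] -/
theorem wtB8_pos (k : ℤ) : 0 < wtB8 k := by
  unfold wtB8 θw gHi ωt
  split_ifs <;> positivity

/-- The tube radii are non-negative. [folklore] -/
theorem tubeRB8_nonneg (k : ℤ) : 0 ≤ tubeRB8 k := by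
  unfold tubeRB8 gHi r₀ κw εR
  split_ifs <;> positivity

/-- `tubeR ≤ 2 · wt` (bounded-metric constant `B = 2`). [cite: Tao2016AveragedNS, §4; cell vocabulary, harvest/h2-tao-ladder rung1/STAGE3-BANACH.md §1 (B_w, B_t)] -/
theorem tubeRB8_le (k : ℤ) : tubeRB8 k ≤ 2 * wtB8 k := by
  unfold tubeRB8 wtB8
  split_ifs with h1 h2
  · -- wake: gHi^n (r₀ + κ n) ≤ 2 (2 gHi)^n, from (1/2)^n n ≤ 1
    set n := (-k).toNat
    have hθ : θw ^ n = 2 ^ n * gHi ^ n := by rw [θw, mul_pow]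
    rw [hθ]
    have hg : 0 < gHi ^ n := by unfold gHi; positivity
    have hn := T4W76.half_pow_mul_le_one n
    have h2n : (1 : ℝ) ≤ 2 ^ n := one_le_pow₀ (by norm_num)
    have hkey : r₀ + κw * (n : ℝ) ≤ 2 * 2 ^ n := by
      rw [one_div, inv_pow, inv_mul_le_iff₀ (by positivity)] at hn
      unfold r₀ κw; nlinarith
    calc gHi ^ n * (r₀ + κw * (n : ℝ)) ≤ gHi ^ n * (2 * 2 ^ n) := mul_le_mul_of_nonneg_left hkey hg.le
      _ = 2 * (2 ^ n * gHi ^ n) := by ring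
  · unfold εR ωt
    have : (0 : ℝ) ≤ (1 / 2) ^ (k - 91).toNat := by positivity
    nlinarith
  · norm_num

/-- `|tubeC| ≤ 2 · wt` when `|ŷ_{·,0}| ≤ cmax`. [cite: Tao2016AveragedNS, §4; cell vocabulary, harvest/h2-tao-ladder rung1/STAGE3-BANACH.md §1] -/
theorem tubeCB8_le {c₀ : Fin 4 → ℝ} (hc : ∀ i, |c₀ i| ≤ cmax) (i : Fin 4) (k : ℤ) :
    |tubeCB8 c₀ i k| ≤ 2 * wtB8 k := by
  unfold tubeCB8 wtB8
  split_ifs with h1 h2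
  · set n := (-k).toNat
    have hci := hc i
    unfold cmax at hci
    rw [abs_mul, abs_of_nonneg (by unfold ghat; positivity)]
    have hpow : ghat ^ n ≤ θw ^ n := pow_le_pow_left₀ (by unfold ghat; norm_num) (by unfold ghat θw gHi; norm_num) n
    have hθ0 : 0 ≤ θw ^ n := by unfold θw gHi; positivity
    calc ghat ^ n * |c₀ i| ≤ θw ^ n * 1 := mul_le_mul hpow (by linarith [abs_nonneg (c₀ i)]) (abs_nonneg _) hθ0
      _ ≤ 2 * θw ^ n := by linarith
  · simp only [abs_zero]; unfold ωt; positivity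
  · norm_num

/-- **The frame of the instance**: window `[0, 91)`, the certificate's box, flight time `τc ± rτ`, the closed-form
tubes and weights above, `B = 2`, edge sup bounds `Eb = 59/100`, `Et = ε`.
[cite: Tao2016AveragedNS, §4, §5.3; cell vocabulary, harvest/h2-tao-ladder rung1/INSTANCE-SHEET-T4-0.1-W76.md (the B8 instance follows the same sheet) (Frame)] -/
def frame (bd : BoxData) : OneShiftFrame 4 where
  W := 91
  D := bd.D
  yc := bd.yc
  a := bd.a
  τc := τc
  rτ := rτ
  tubeC := tubeCB8 fun i => bd.yc i 0
  tubeR := tubeRB8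
  wt := wtB8
  B := 2
  Eb := 59 / 100
  Et := εR
  strig := bd.strig
  a_pos := bd.a_pos
  rτ_pos := by unfold rτ; norm_num
  τc_gt := by unfold rτ τc; norm_num
  wt_pos := wtB8_pos
  tubeR_nonneg := tubeRB8_nonneg
  tubeR_le := tubeRB8_le
  tubeC_le := tubeCB8_le bd.yc_le

/-! ### The functions fed to `…_v7s` -/

/-- Amplitude hulls `A`: `Q β^{|k|}` (wake), `ε 2^{-(k-91)}` (top), and on the window `0.57474` (shell 0),
`ā_t` (shell 90), `1.11` (shells 1 … 89) — upper bounds of the engine's `umax` column. [cite: Tao2016AveragedNS, §4 Lemma 4.1 (4.5); cell vocabulary, harvest/h2-tao-ladder rung1/logs/num4c (dump column umax)] -/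
def AB8 (k : ℤ) : ℝ :=
  if k < 0 then Q * βw ^ (-k).toNat
  else if 91 ≤ k then εR * (1 / 2) ^ (k - 91).toNat
  else if k = 0 then 57474 / 10 ^ 5 else if k = 90 then abart else 111 / 100

/-- Time-Lipschitz rate envelopes `R` (table-sparse form of `…_v7s`): `(S Q² β²)(β²/Λ₀)^{|k|}` on the wake,
`(S ā_t² Λ₀^91)(Λ₀/4)^{k-91}` on the top, `0` on the window. [cite: Tao2016AveragedNS, §4 Lemma 4.1 (4.8); cell vocabulary, module …OneShiftSparseClosedForm (hRW/hRT)] -/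
def RB8 (k : ℤ) : ℝ :=
  if k < 0 then (S * Q ^ 2 * βw ^ 2) * (βw ^ 2 * (bigLam (2 / 25))⁻¹) ^ (-k).toNat
  else if 91 ≤ k then (S * abart ^ 2 * bigLam (2 / 25) ^ 91) * (bigLam (2 / 25) * (1 / 2) ^ 2) ^ (k - 91).toNat
  else 0

/-- Per-shell window Lipschitz numbers w.r.t. the point distance (`vmax` column; three pieces). [cite: Tao2016AveragedNS, §4; cell vocabulary, harvest/h2-tao-ladder rung1/logs/num4c (dump column vmax)] -/
def vmaxB8 (k : ℤ) : ℝ :=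
  if k = 0 then 111 / 10 ^ 10 else if k = 90 then 101 / 10 ^ 26 else 27 / 10 ^ 9

/-- Per-shell window Lipschitz numbers w.r.t. the wake-edge input (`chiPmax · c_π`; three pieces). [cite: Tao2016AveragedNS, §4; cell vocabulary, harvest/h2-tao-ladder rung1/logs/num4c (dump column chiPmax, c_π = 0.8263)] -/
def χbB8 (k : ℤ) : ℝ :=
  if k = 0 then 182 / 10 ^ 7 else if k = 90 then 1 / 10 ^ 44 else 1 / 10 ^ 14

/-- Per-shell window Lipschitz numbers w.r.t. the top-edge input (`chiLmax · c_ℓ,out`; three pieces). [cite: Tao2016AveragedNS, §4; cell vocabulary, harvest/h2-tao-ladder rung1/logs/num4c (dump column chiLmax, c_ℓ,out = 2.855e-17)] -/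
def χeB8 (k : ℤ) : ℝ :=
  if k = 0 then 1 / 10 ^ 60 else if k = 90 then 63 / 10 ^ 23 else 1 / 10 ^ 58

end B8E8W91

end DSSOneShift

end Summit.NavierStokesRegularity.NavierStokesRegularity.Theorems
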